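/-
Copyright: cell `pub-balaban-gaps` (G2), seat ne6 (row NE7b), `prover-pub-balaban-gaps-ne6-g11-0`. Released under the licence of the
surrounding project.
-/
import Summits.QuantumFields.BalabanUV.T4Continuum.Spine.NE7b.CompactFibreWindowSU2
import Literature.MathematicalPhysics.QuantumFieldTheory.UnitaryCayleyChart

/-!
# THE WINDOW-VOLUME LETTER `κ(G)` BY VALUE FOR THE HEADLINE's GROUP `SU(N)`, ALL `N`: Haar_{SU(N)}{‖V − 1‖ ≤ η} ≥ C_N (η∕2)^{N²}
# from the TREE's `U(N)` small-ball bound by AVERAGED SECTIONS over the subgroup — hence `−log κ(Π_b W_η) ≤ #bonds·(N² log(2∕η) − log C_N)`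
# (row NE7b, node U5c; sibling of `CompactFibreWindowSU2`, whose `N = 2` constants are explicit)

Cell `pub-balaban-gaps` (G2 spine census) for the `pub-balaban` T⁴ crux NE7b (`T4WeightBudget.RelWeightBound`; the cell's OWN
estimate — NOT PRINTED in [Bałaban 1983–89], NOT PROVED).  Crux-route work under `Spine/NE7b/`; NOTHING of Bałaban's is named or
asserted; no `T4Continuum/Support` leaf typed; no `def`; zero `sorry`.  Imports: this seat's `CompactFibreWindowSU2` (for the OWNER's
`CompactFibreCarrier` and the generic junction `compactFibre_moment_le_window_exp`) and the tree's `UnitaryCayleyChart` (Chatterjee 2016: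
`exists_haar_gball_ge`, `re_trace_one_sub`, `norm_one_sub_plaquetteWord_le` for `U(N)`).

WHY.  The headline `…T4ContinuumYM4Torus.continuumYM4_torus_of_BetaPertH` is stated for `Matrix.specialUnitaryGroup (Fin N) ℂ`, every `N`.
`CompactFibreWindowSU2` supplies the OWNER g106's RULING-4 letter `κ(G)` BY VALUE for `N = 2` from the quaternion model.  For general `N` the
TREE holds the `U(N)` value — `Literature.MathematicalPhysics.QuantumFieldTheory.UnitaryCayley.exists_haar_gball_ge`: `σ_{U(N)}(B(1, δ)) ≥ C δ^{N²}`
for `0 < δ ≤ 1` (Chatterjee, J. Funct. Anal. 271 (2016), Cor. 6.3, PROVED in the tree by the Cayley chart) — but `SU(N) ⊂ U(N)` is a NULL set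
of `σ_{U(N)}`, so the value does not transfer by restriction.  It transfers by AVERAGING SECTIONS ([folklore]): for compact groups
`ι : H →* G` and a measurable `A ⊆ G`, left invariance of `μ_G` under `ι(H)` and Tonelli give
**`μ_G(A) = ∫ μ_H{h : ι(h)·g ∈ A} dμ_G(g)`** (`haar_eq_lintegral_sections`), so `μ_G(A) ≤ sup_g μ_H(section)`; and every `SU(N)`-section of
the `U(N)`-ball `B(1, δ)` lies in a left translate of the `SU(N)`-ball `B(1, 2δ)` (two points of a `δ`-section are `2δ` apart in the
unitarily invariant Hilbert–Schmidt norm).  Hence **`Haar_{SU(N)}(B(1, 2δ)) ≥ σ_{U(N)}(B(1, δ)) ≥ C δ^{N²}`** (`haar_gball_le_haar_sball`,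
`exists_haar_sball_ge`) — no chart of `SU(N)`, no determinant estimate, no factorisation of Haar measure.

WHAT IS PROVED ([folklore]; Mathlib's `measure_preimage_mul`, `lintegral_lintegral_swap`, `lintegral_indicator_one`; the tree's
`frobenius_norm_unitaryGroup_mul` ∕ `_mul_unitaryGroup`):
* §1 `haar_eq_lintegral_sections`, `haar_le_of_sections_le` (any compact second-countable `H →* G`).
* §2 `SU(N) ↪ U(N)`: the sections of `B_{U(N)}(1, δ)` (`section_subset_preimage_sball`, `haar_section_le`),
  **`haar_gball_le_haar_sball`** (`σ_{U(N)}(B(1,δ)) ≤ Haar_{SU(N)}(B(1,2δ))`), **`exists_haar_sball_ge`** (`∃ C > 0, ∀ 0 < η ≤ 2,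
  C·(η∕2)^{N²} ≤ Haar_{SU(N)}{‖V − 1‖ ≤ η}`), `exists_neg_log_haar_sball_le` (`−log ≤ N²·log(2∕η) − log C`), and the trace dictionary
  `sball_eq_traceWindow` (`{‖V − 1‖ ≤ η} = {Re tr(1 − V) ≤ η²∕2}`, the tree's `re_trace_one_sub`).
* §3a `volumeRatio_le_exp_of_window` — the ADAPTER to the OWNER's (9) `CompactFibreLCS.compactCarrier_le` letter `hfrac`: on a probability fibre,
  `−log κ(W) ≤ c` and `0 ≤ F ≤ 1` give `(∫F dκ)∕(∫𝟙_W dκ) ≤ e^{c}` (chair leaf-05 g137's K6 junction, as a named lemma).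
* §3 A REGION: product Haar on `bonds → SU(N)`: `pi_sball_toReal_eq`, **`exists_neg_log_pi_sball_le`**
  (`−log κ(Π_b W_η) ≤ #bonds·(N²·log(2∕η) − log C)` — the per-degree-of-freedom price BY VALUE, all `N`), and the junction
  **`exists_compactFibre_moment_le_SUNwindow`** with the OWNER's display (price `exp(i⁺ + #bonds·(N²·log(2∕η) − log C))`).
* §4 THE OTHER LETTER `i⁺` for `U(N) ⊇ SU(N)`, straight from the tree's Lemma 7.2 ∕ 7.4: `re_trace_one_sub_plaquetteWord_le`
  (`Re tr(1 − U₁U₂U₃⁻¹U₄⁻¹) ≤ 8ε²` when `‖1 − Uᵢ‖ ≤ ε`), `interaction_le_of_window_unitary` (`Σ_{p∈s} β·Re tr(1 − U_p) ≤ #s·8βε²` over the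
  plaquettes touching the region when every bond variable is within `ε` of the identity — the `hIsmall : I ≤ i⁺` letter for the unnormalised
  Wilson plaquette terms; the `1∕N`-normalised trace only lowers it).

HONEST REMARKS.  The constant `C = C_N` is Chatterjee's SOFT constant (existential, from a Lebesgue density point; the tree does not value
it) — the letter is BY VALUE in `η` and `#bonds`, by NAME in `C_N`; the exponent `N²` is `dim U(N)`, not `dim SU(N) = N² − 1` (any power law
gives «O(log η⁻¹) per bond»).  Which window ∕ `η(g_j)` print uses at a creation step and that Bałaban's creation-level carrier IS the compact-fibre
one are (A3) ∕ (A1c) readings — NOT asserted.  Nothing of Bałaban's is asserted, valued or discharged.  NE7b NOT PRINTED ∕ NOT PROVED; spine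
PROVED 0∕9; rung (B)+1 on a FINITE torus — NOT infinite volume, NOT the mass gap, NOT Clay.
HONEST DEPENDENCY: continuum YM on T⁴ ⇐ BetaPertH ∧ nine spine estimates (0/9 proved); BetaPertH ⇐ (D1) ∧ (D4) ∧ CAP+tail;
G-an2-4 gates asym, D1 and NE2/3/4.  This file changes none of it.
-/

set_option autoImplicit false

open MeasureTheory Real Finset
open scoped Matrix.Norms.Frobenius ENNReal
open Literature.MathematicalPhysics.QuantumFieldTheory (haarProbability)
open Literature.MathematicalPhysics.QuantumFieldTheory.UnitaryCayley (gball mem_gball measurableSet_gball exists_haar_gball_ge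
  re_trace_one_sub norm_one_sub_plaquetteWord_le)
open Summit.QuantumFields.BalabanUV.T4Continuum.NE7b.CompactFibreCarrier
open Summit.QuantumFields.BalabanUV.T4Continuum.NE7b.CompactFibreWindowSU2 (compactFibre_moment_le_window_exp)

namespace Summit.QuantumFields.BalabanUV.T4Continuum.NE7b.CompactFibreWindowSUN

noncomputable section

/-! ## §1 Averaged sections: `μ_G(A) = ∫ μ_H{h : ι(h)·g ∈ A} dμ_G(g)` for compact `ι : H →* G` -/

section Generic

variable {H G : Type*} [Group H] [TopologicalSpace H] [IsTopologicalGroup H] [CompactSpace H] [MeasurableSpace H] [BorelSpace H]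
  [Group G] [TopologicalSpace G] [IsTopologicalGroup G] [CompactSpace G] [MeasurableSpace G] [BorelSpace G] [SecondCountableTopology G]

/-- **AVERAGED SECTIONS.**  For a continuous homomorphism `ι : H →* G` of compact groups (`G` second countable) and a measurable `A ⊆ G`:
`μ_G(A) = ∫ μ_H{h : ι(h)·g ∈ A} dμ_G(g)` — left invariance of `μ_G` under each `ι(h)` makes `μ_G(A) = ∫_H μ_G(ι(h)⁻¹A) dμ_H`, and Tonelli
swaps the two Haar integrals. [folklore] -/
theorem haar_eq_lintegral_sections (ι : H →* G) (hι : Continuous ι) {A : Set G} (hA : MeasurableSet A) :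
    haarProbability G A = ∫⁻ g, haarProbability H {h | ι h * g ∈ A} ∂(haarProbability G) := by
  have hm : Measurable fun p : H × G => ι p.1 * p.2 := ((hι.comp continuous_fst).mul continuous_snd).measurable
  have hF : Measurable fun p : H × G => A.indicator (1 : G → ℝ≥0∞) (ι p.1 * p.2) :=
    (measurable_one.indicator hA).comp hm
  have hsec : ∀ g : G, MeasurableSet {h : H | ι h * g ∈ A} := fun g =>
    hA.preimage ((hι.mul continuous_const).measurable)
  calc haarProbability G A
      = ∫⁻ _h, haarProbability G A ∂(haarProbability H) := by rw [lintegral_const, measure_univ, mul_one]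
    _ = ∫⁻ h, haarProbability G ((fun g => ι h * g) ⁻¹' A) ∂(haarProbability H) := by
        refine lintegral_congr fun h => ?_
        rw [measure_preimage_mul]
    _ = ∫⁻ h, ∫⁻ g, A.indicator (1 : G → ℝ≥0∞) (ι h * g) ∂(haarProbability G) ∂(haarProbability H) := by
        refine lintegral_congr fun h => ?_
        rw [← lintegral_indicator_one (hA.preimage (measurable_const_mul (ι h)))]
        rfl
    _ = ∫⁻ g, ∫⁻ h, A.indicator (1 : G → ℝ≥0∞) (ι h * g) ∂(haarProbability H) ∂(haarProbability G) :=
        lintegral_lintegral_swap hF.aemeasurable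
    _ = ∫⁻ g, haarProbability H {h | ι h * g ∈ A} ∂(haarProbability G) := by
        refine lintegral_congr fun g => ?_
        rw [← lintegral_indicator_one (hsec g)]
        rfl

/-- Hence a UNIFORM bound on the sections bounds the measure: `(∀ g, μ_H{h : ι(h)·g ∈ A} ≤ c) ⊢ μ_G(A) ≤ c`. [folklore] -/
theorem haar_le_of_sections_le (ι : H →* G) (hι : Continuous ι) {A : Set G} (hA : MeasurableSet A) {c : ℝ≥0∞}
    (hc : ∀ g : G, haarProbability H {h | ι h * g ∈ A} ≤ c) : haarProbability G A ≤ c := by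
  rw [haar_eq_lintegral_sections ι hι hA]
  calc ∫⁻ g, haarProbability H {h | ι h * g ∈ A} ∂(haarProbability G)
      ≤ ∫⁻ _g, c ∂(haarProbability G) := lintegral_mono hc
    _ = c := by rw [lintegral_const, measure_univ, mul_one]

end Generic

/-! ## §2 `SU(N) ↪ U(N)`: sections of the `U(N)` Hilbert–Schmidt ball are small `SU(N)` balls

Conventions: `U(N) = Matrix.unitaryGroup (Fin N) ℂ`, `SU(N) = Matrix.specialUnitaryGroup (Fin N) ℂ`, the inclusion is Mathlib's
`Submonoid.inclusion Matrix.specialUnitaryGroup_le_unitaryGroup`, and the Hilbert–Schmidt ball `SB η` of the prose is the plain set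
`{V : Matrix.specialUnitaryGroup (Fin N) ℂ | ‖(V : Matrix (Fin N) (Fin N) ℂ) - 1‖ ≤ η}` — all written out in full (nothing abbreviated, nothing defined). -/

section SUN

variable {N : ℕ}

/-- The inclusion is continuous. [folklore] -/
theorem continuous_inclusion_sun : Continuous (Submonoid.inclusion (Matrix.specialUnitaryGroup_le_unitaryGroup (n := Fin N) (α := ℂ))) :=
  continuous_subtype_val.subtype_mk _

/-- The inclusion does not change the underlying matrix. [folklore] -/
theorem coe_inclusion_sun (h : Matrix.specialUnitaryGroup (Fin N) ℂ) : (((Submonoid.inclusion (Matrix.specialUnitaryGroup_le_unitaryGroup (n := Fin N) (α := ℂ))) h : Matrix.unitaryGroup (Fin N) ℂ) : Matrix (Fin N) (Fin N) ℂ) = (h : Matrix (Fin N) (Fin N) ℂ) := rfl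

/-- The `SU(N)` ball is closed, hence measurable. [folklore] -/
theorem measurableSet_sball (η : ℝ) : MeasurableSet {V : Matrix.specialUnitaryGroup (Fin N) ℂ | ‖(V : Matrix (Fin N) (Fin N) ℂ) - 1‖ ≤ η} := by
  have hc : Continuous fun V : (Matrix.specialUnitaryGroup (Fin N) ℂ) => ‖(V : Matrix (Fin N) (Fin N) ℂ) - 1‖ := (continuous_subtype_val.sub continuous_const).norm
  exact (isClosed_le hc continuous_const).measurableSet

/-- Two points of a `δ`-section are `2δ` apart: if `‖h₁·g − 1‖ ≤ δ` and `‖h·g − 1‖ ≤ δ` (Hilbert–Schmidt, `g ∈ U(N)`, `h, h₁ ∈ SU(N)`) then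
`‖h₁⁻¹h − 1‖ ≤ 2δ` (unitary invariance of the norm on both sides). [folklore] -/
theorem norm_inv_mul_sub_one_le {δ : ℝ} (g : Matrix.unitaryGroup (Fin N) ℂ) {h₁ h : (Matrix.specialUnitaryGroup (Fin N) ℂ)} (hh₁ : ‖(h₁ : Matrix (Fin N) (Fin N) ℂ) * (g : Matrix (Fin N) (Fin N) ℂ) - 1‖ ≤ δ) (hh : ‖(h : Matrix (Fin N) (Fin N) ℂ) * (g : Matrix (Fin N) (Fin N) ℂ) - 1‖ ≤ δ) :
    ‖((h₁⁻¹ * h : Matrix.specialUnitaryGroup (Fin N) ℂ) : Matrix (Fin N) (Fin N) ℂ) - 1‖ ≤ 2 * δ := by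
  -- `h₁⁻¹` as an element of `U(N)`
  have hmem : ((h₁⁻¹ : Matrix.specialUnitaryGroup (Fin N) ℂ) : Matrix (Fin N) (Fin N) ℂ) ∈ Matrix.unitaryGroup (Fin N) ℂ := (Matrix.mem_specialUnitaryGroup_iff.1 (h₁⁻¹).2).1
  have e0 : ((h₁⁻¹ : Matrix.specialUnitaryGroup (Fin N) ℂ) : Matrix (Fin N) (Fin N) ℂ) * (h₁ : Matrix (Fin N) (Fin N) ℂ) = 1 := by
    rw [← Submonoid.coe_mul, inv_mul_cancel]; rfl
  have e1 : ((h₁⁻¹ * h : Matrix.specialUnitaryGroup (Fin N) ℂ) : Matrix (Fin N) (Fin N) ℂ) - 1 = ((h₁⁻¹ : Matrix.specialUnitaryGroup (Fin N) ℂ) : Matrix (Fin N) (Fin N) ℂ) * ((h : Matrix (Fin N) (Fin N) ℂ) - (h₁ : Matrix (Fin N) (Fin N) ℂ)) := by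
    rw [Matrix.mul_sub, e0, Submonoid.coe_mul]
  have e2 : ‖((h₁⁻¹ : Matrix.specialUnitaryGroup (Fin N) ℂ) : Matrix (Fin N) (Fin N) ℂ) * ((h : Matrix (Fin N) (Fin N) ℂ) - (h₁ : Matrix (Fin N) (Fin N) ℂ))‖ = ‖(h : Matrix (Fin N) (Fin N) ℂ) - (h₁ : Matrix (Fin N) (Fin N) ℂ)‖ :=
    Matrix.frobenius_norm_unitaryGroup_mul ⟨((h₁⁻¹ : Matrix.specialUnitaryGroup (Fin N) ℂ) : Matrix (Fin N) (Fin N) ℂ), hmem⟩ _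
  have e3 : ‖(h : Matrix (Fin N) (Fin N) ℂ) - (h₁ : Matrix (Fin N) (Fin N) ℂ)‖ = ‖((h : Matrix (Fin N) (Fin N) ℂ) * (g : Matrix (Fin N) (Fin N) ℂ) - 1) - ((h₁ : Matrix (Fin N) (Fin N) ℂ) * (g : Matrix (Fin N) (Fin N) ℂ) - 1)‖ := by
    rw [sub_sub_sub_cancel_right, ← Matrix.sub_mul, Matrix.frobenius_norm_mul_unitaryGroup]
  rw [e1, e2, e3]
  calc _ ≤ ‖(h : Matrix (Fin N) (Fin N) ℂ) * (g : Matrix (Fin N) (Fin N) ℂ) - 1‖ + ‖(h₁ : Matrix (Fin N) (Fin N) ℂ) * (g : Matrix (Fin N) (Fin N) ℂ) - 1‖ := norm_sub_le _ _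
    _ ≤ 2 * δ := by linarith

/-- Hence a `δ`-section through `h₁` lies in the left translate `h₁·SB(2δ)`, i.e. in the preimage of `SB(2δ)` under `h ↦ h₁⁻¹h`. [folklore] -/
theorem section_subset_preimage_sball {δ : ℝ} (g : Matrix.unitaryGroup (Fin N) ℂ) {h₁ : (Matrix.specialUnitaryGroup (Fin N) ℂ)} (hh₁ : ‖(h₁ : Matrix (Fin N) (Fin N) ℂ) * (g : Matrix (Fin N) (Fin N) ℂ) - 1‖ ≤ δ) :
    {h : (Matrix.specialUnitaryGroup (Fin N) ℂ) | ‖(h : Matrix (Fin N) (Fin N) ℂ) * (g : Matrix (Fin N) (Fin N) ℂ) - 1‖ ≤ δ} ⊆ (fun h : (Matrix.specialUnitaryGroup (Fin N) ℂ) => h₁⁻¹ * h) ⁻¹' {V : Matrix.specialUnitaryGroup (Fin N) ℂ | ‖(V : Matrix (Fin N) (Fin N) ℂ) - 1‖ ≤ 2 * δ} :=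
  fun _ hh => norm_inv_mul_sub_one_le g hh₁ hh

/-- **SECTIONS ARE SMALL**: `Haar_{SU(N)}{h : ‖h·g − 1‖ ≤ δ} ≤ Haar_{SU(N)}(SB(2δ))` for every `g ∈ U(N)` (left invariance; an empty
section costs nothing). [folklore] -/
theorem haar_section_le (g : Matrix.unitaryGroup (Fin N) ℂ) (δ : ℝ) :
    haarProbability (Matrix.specialUnitaryGroup (Fin N) ℂ) {h : (Matrix.specialUnitaryGroup (Fin N) ℂ) | ‖(h : Matrix (Fin N) (Fin N) ℂ) * (g : Matrix (Fin N) (Fin N) ℂ) - 1‖ ≤ δ} ≤ haarProbability (Matrix.specialUnitaryGroup (Fin N) ℂ) {V : Matrix.specialUnitaryGroup (Fin N) ℂ | ‖(V : Matrix (Fin N) (Fin N) ℂ) - 1‖ ≤ 2 * δ} := by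
  by_cases hne : ∃ h₁ : (Matrix.specialUnitaryGroup (Fin N) ℂ), ‖(h₁ : Matrix (Fin N) (Fin N) ℂ) * (g : Matrix (Fin N) (Fin N) ℂ) - 1‖ ≤ δ
  · obtain ⟨h₁, hh₁⟩ := hne
    calc haarProbability (Matrix.specialUnitaryGroup (Fin N) ℂ) {h : (Matrix.specialUnitaryGroup (Fin N) ℂ) | ‖(h : Matrix (Fin N) (Fin N) ℂ) * (g : Matrix (Fin N) (Fin N) ℂ) - 1‖ ≤ δ}
        ≤ haarProbability (Matrix.specialUnitaryGroup (Fin N) ℂ) ((fun h : (Matrix.specialUnitaryGroup (Fin N) ℂ) => h₁⁻¹ * h) ⁻¹' {V : Matrix.specialUnitaryGroup (Fin N) ℂ | ‖(V : Matrix (Fin N) (Fin N) ℂ) - 1‖ ≤ 2 * δ}) := measure_mono (section_subset_preimage_sball g hh₁)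
      _ = haarProbability (Matrix.specialUnitaryGroup (Fin N) ℂ) {V : Matrix.specialUnitaryGroup (Fin N) ℂ | ‖(V : Matrix (Fin N) (Fin N) ℂ) - 1‖ ≤ 2 * δ} := measure_preimage_mul _ _ _
  · have hempty : {h : (Matrix.specialUnitaryGroup (Fin N) ℂ) | ‖(h : Matrix (Fin N) (Fin N) ℂ) * (g : Matrix (Fin N) (Fin N) ℂ) - 1‖ ≤ δ} = ∅ :=
      Set.eq_empty_of_forall_notMem fun h hh => hne ⟨h, hh⟩
    rw [hempty, measure_empty]
    exact bot_le

/-- **`σ_{U(N)}(B(1, δ)) ≤ Haar_{SU(N)}(SB(2δ))`** — averaged sections (§1) + small sections. [folklore] -/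
theorem haar_gball_le_haar_sball (δ : ℝ) : haarProbability (Matrix.unitaryGroup (Fin N) ℂ) (gball N δ) ≤ haarProbability (Matrix.specialUnitaryGroup (Fin N) ℂ) {V : Matrix.specialUnitaryGroup (Fin N) ℂ | ‖(V : Matrix (Fin N) (Fin N) ℂ) - 1‖ ≤ 2 * δ} := by
  refine haar_le_of_sections_le (Submonoid.inclusion (Matrix.specialUnitaryGroup_le_unitaryGroup (n := Fin N) (α := ℂ))) continuous_inclusion_sun (measurableSet_gball δ) fun g => ?_
  have hset : {h : (Matrix.specialUnitaryGroup (Fin N) ℂ) | (Submonoid.inclusion (Matrix.specialUnitaryGroup_le_unitaryGroup (n := Fin N) (α := ℂ))) h * g ∈ gball N δ} = {h : (Matrix.specialUnitaryGroup (Fin N) ℂ) | ‖(h : Matrix (Fin N) (Fin N) ℂ) * (g : Matrix (Fin N) (Fin N) ℂ) - 1‖ ≤ δ} := by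
    ext h
    simp only [Set.mem_setOf_eq, mem_gball, Submonoid.coe_mul, coe_inclusion_sun]
  rw [hset]
  exact haar_section_le g δ

/-- **SMALL BALLS OF `SU(N)` HAVE HAAR MEASURE `≥ C (η∕2)^{N²}`** (`0 < η ≤ 2`), with Chatterjee's soft `U(N)` constant `C = C_N > 0` of the
tree's `UnitaryCayley.exists_haar_gball_ge`. [folklore] -/
theorem exists_haar_sball_ge :
    ∃ C : ℝ, 0 < C ∧ ∀ η : ℝ, 0 < η → η ≤ 2 →
      ENNReal.ofReal (C * (η / 2) ^ (N * N)) ≤ haarProbability (Matrix.specialUnitaryGroup (Fin N) ℂ) {V : Matrix.specialUnitaryGroup (Fin N) ℂ | ‖(V : Matrix (Fin N) (Fin N) ℂ) - 1‖ ≤ η} := by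
  obtain ⟨C, hC, hball⟩ := exists_haar_gball_ge (N := N)
  refine ⟨C, hC, fun η hη hη2 => ?_⟩
  have h := (hball (η / 2) (by positivity) (by linarith)).trans (haar_gball_le_haar_sball (η / 2))
  rwa [mul_div_cancel₀ η two_ne_zero] at h

/-- The same in real form, with the per-bond price: `∃ C > 0, ∀ 0 < η ≤ 2, C(η∕2)^{N²} ≤ Haar(SB η).toReal ∧ −log Haar(SB η).toReal ≤ N²·log(2∕η) − log C`.
[folklore] -/
theorem exists_neg_log_haar_sball_le :
    ∃ C : ℝ, 0 < C ∧ ∀ η : ℝ, 0 < η → η ≤ 2 →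
      C * (η / 2) ^ (N * N) ≤ (haarProbability (Matrix.specialUnitaryGroup (Fin N) ℂ) {V : Matrix.specialUnitaryGroup (Fin N) ℂ | ‖(V : Matrix (Fin N) (Fin N) ℂ) - 1‖ ≤ η}).toReal ∧
        -Real.log (haarProbability (Matrix.specialUnitaryGroup (Fin N) ℂ) {V : Matrix.specialUnitaryGroup (Fin N) ℂ | ‖(V : Matrix (Fin N) (Fin N) ℂ) - 1‖ ≤ η}).toReal ≤ (N * N : ℝ) * Real.log (2 / η) - Real.log C := by
  obtain ⟨C, hC, hball⟩ := exists_haar_sball_ge (N := N)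
  refine ⟨C, hC, fun η hη hη2 => ?_⟩
  have hpos : 0 < C * (η / 2) ^ (N * N) := by positivity
  have hreal : C * (η / 2) ^ (N * N) ≤ (haarProbability (Matrix.specialUnitaryGroup (Fin N) ℂ) {V : Matrix.specialUnitaryGroup (Fin N) ℂ | ‖(V : Matrix (Fin N) (Fin N) ℂ) - 1‖ ≤ η}).toReal :=
    (ENNReal.ofReal_le_iff_le_toReal (measure_ne_top _ _)).1 (hball η hη hη2)
  refine ⟨hreal, ?_⟩
  have hlog := Real.log_le_log hpos hreal
  rw [Real.log_mul hC.ne' (by positivity), Real.log_pow, Real.log_div hη.ne' two_ne_zero] at hlog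
  rw [Real.log_div two_ne_zero hη.ne']
  push_cast at hlog ⊢
  linarith

/-- **TRACE DICTIONARY** (the tree's Lemma 7.2 `re_trace_one_sub`): on `SU(N)` the Hilbert–Schmidt ball IS a trace window,
`{‖V − 1‖ ≤ η} = {Re tr(1 − V) ≤ η²∕2}` for `η ≥ 0`. [folklore] -/
theorem sball_eq_traceWindow {η : ℝ} (hη : 0 ≤ η) :
    {V : Matrix.specialUnitaryGroup (Fin N) ℂ | ‖(V : Matrix (Fin N) (Fin N) ℂ) - 1‖ ≤ η} = {V : (Matrix.specialUnitaryGroup (Fin N) ℂ) | (Matrix.trace (1 - (V : Matrix (Fin N) (Fin N) ℂ))).re ≤ η ^ 2 / 2} := by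
  ext V
  simp only [Set.mem_setOf_eq]
  rw [re_trace_one_sub (Matrix.mem_specialUnitaryGroup_iff.1 V.2).1, norm_sub_rev]
  constructor
  · intro h
    have h2 := pow_le_pow_left₀ (norm_nonneg _) h 2
    linarith
  · intro h
    have h2 : ‖(1 : Matrix (Fin N) (Fin N) ℂ) - (V : Matrix (Fin N) (Fin N) ℂ)‖ ^ 2 ≤ η ^ 2 := by linarith
    exact (pow_le_pow_iff_left₀ (norm_nonneg _) hη two_ne_zero).1 h2

end SUN

/-! ## §3a The volume-ratio letter of the OWNER's `CompactFibreLCS.compactCarrier_le` (`hfrac`), from a `−log κ(W)` bound -/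

section VolumeRatio

variable {K : Type*} [MeasurableSpace K] (κ : Measure K) [IsProbabilityMeasure κ]

/-- **THE `hfrac` ADAPTER.**  On a probability near fibre, a window `W` with `−log κ(W) ≤ c` and a numerator factor `0 ≤ F ≤ 1` give
`(∫F dκ) ∕ (∫𝟙_W dκ) ≤ e^{c}` — the displayed volume-ratio letter of the OWNER's (9) `CompactFibreLCS.compactCarrier_le` at `G := 𝟙_W`,
`b_vol := c`; with §3's `exists_neg_log_pi_sball_le` (all `N`) or `CompactFibreWindowSU2.neg_log_pi_traceWindow_le` (`N = 2`, explicit) as the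
source of `c`. [folklore] -/
theorem volumeRatio_le_exp_of_window (W : Set K) (hW : MeasurableSet W) (F : K → ℝ) (hF1 : ∀ x, F x ≤ 1) (hFi : Integrable F κ)
    (hWpos : 0 < (κ W).toReal) {c : ℝ} (hc : -Real.log (κ W).toReal ≤ c) :
    (∫ x, F x ∂κ) / (∫ x, W.indicator (1 : K → ℝ) x ∂κ) ≤ exp c := by
  have hGint : ∫ x, W.indicator (1 : K → ℝ) x ∂κ = (κ W).toReal := by rw [integral_indicator_one hW, measureReal_def]
  have hF_le : ∫ x, F x ∂κ ≤ 1 := by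
    calc ∫ x, F x ∂κ ≤ ∫ _x, (1 : ℝ) ∂κ := integral_mono hFi (integrable_const 1) hF1
      _ = 1 := by simp
  rw [hGint, div_le_iff₀ hWpos]
  calc ∫ x, F x ∂κ ≤ 1 := hF_le
    _ = exp c * exp (-c) := by rw [← exp_add, add_neg_cancel, exp_zero]
    _ ≤ exp c * (κ W).toReal := by
        refine mul_le_mul_of_nonneg_left ?_ (exp_pos _).le
        have h := Real.exp_le_exp.mpr (neg_le.mpr hc)
        rwa [Real.exp_log hWpos] at h

end VolumeRatio

/-! ## §3 A region: the product Haar window over its bonds, all `N` — and the junction with the OWNER's display -/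

section Region

variable {N : ℕ} {B : Type*} [Fintype B]

/-- Product window, product mass (the OWNER's `pi_window_measure` at equal factors). [folklore] -/
theorem pi_sball_toReal_eq (η : ℝ) :
    ((Measure.pi fun _ : B => haarProbability (Matrix.specialUnitaryGroup (Fin N) ℂ)) (Set.univ.pi fun _ : B => {V : Matrix.specialUnitaryGroup (Fin N) ℂ | ‖(V : Matrix (Fin N) (Fin N) ℂ) - 1‖ ≤ η})).toReal
      = ((haarProbability (Matrix.specialUnitaryGroup (Fin N) ℂ) {V : Matrix.specialUnitaryGroup (Fin N) ℂ | ‖(V : Matrix (Fin N) (Fin N) ℂ) - 1‖ ≤ η}).toReal) ^ Fintype.card B := by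
  rw [pi_window_measure, Finset.prod_const, Finset.card_univ]

/-- **THE PER-DEGREE-OF-FREEDOM PRICE BY VALUE, ALL `N`**: `∃ C > 0, ∀ 0 < η ≤ 2`, the product window has positive mass and
`−log κ(Π_b SB η) ≤ #bonds·(N²·log(2∕η) − log C)`. [folklore] -/
theorem exists_neg_log_pi_sball_le :
    ∃ C : ℝ, 0 < C ∧ ∀ η : ℝ, 0 < η → η ≤ 2 →
      0 < ((Measure.pi fun _ : B => haarProbability (Matrix.specialUnitaryGroup (Fin N) ℂ)) (Set.univ.pi fun _ : B => {V : Matrix.specialUnitaryGroup (Fin N) ℂ | ‖(V : Matrix (Fin N) (Fin N) ℂ) - 1‖ ≤ η})).toReal ∧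
        -Real.log ((Measure.pi fun _ : B => haarProbability (Matrix.specialUnitaryGroup (Fin N) ℂ)) (Set.univ.pi fun _ : B => {V : Matrix.specialUnitaryGroup (Fin N) ℂ | ‖(V : Matrix (Fin N) (Fin N) ℂ) - 1‖ ≤ η})).toReal
          ≤ (Fintype.card B : ℝ) * ((N * N : ℝ) * Real.log (2 / η) - Real.log C) := by
  obtain ⟨C, hC, h⟩ := exists_neg_log_haar_sball_le (N := N)
  refine ⟨C, hC, fun η hη hη2 => ?_⟩
  obtain ⟨hreal, hlog⟩ := h η hη hη2
  have hpos : 0 < (haarProbability (Matrix.specialUnitaryGroup (Fin N) ℂ) {V : Matrix.specialUnitaryGroup (Fin N) ℂ | ‖(V : Matrix (Fin N) (Fin N) ℂ) - 1‖ ≤ η}).toReal := lt_of_lt_of_le (by positivity) hreal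
  refine ⟨?_, ?_⟩
  · rw [pi_sball_toReal_eq]; exact pow_pos hpos _
  · rw [pi_sball_toReal_eq, Real.log_pow, ← mul_neg]
    exact mul_le_mul_of_nonneg_left hlog (Nat.cast_nonneg _)

/-- **THE JUNCTION FOR THE `SU(N)` PRODUCT FIBRE, ALL `N`**: `∃ C > 0` such that for every window size `0 < η ≤ 2`, on the near fibre
`bonds → SU(N)` with the product Haar probability and the product Hilbert–Schmidt window, a numerator factor `0 ≤ F ≤ 1` carried by POSITIVITY
(`I ≥ 0` where `F·w ≠ 0`) and an interaction `≤ i⁺` on the window give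
`∫ F·w·e^{−I} d(κ⊗μ) ≤ exp(i⁺ + #bonds·(N²·log(2∕η) − log C)) · ∫ 𝟙_W·w·e^{−I} d(κ⊗μ)`. [folklore] -/
theorem exists_compactFibre_moment_le_SUNwindow {Y : Type*} [MeasurableSpace Y] (μ : Measure Y) [SFinite μ] :
    ∃ C : ℝ, 0 < C ∧ ∀ η : ℝ, 0 < η → η ≤ 2 →
      ∀ (F : (B → (Matrix.specialUnitaryGroup (Fin N) ℂ)) → ℝ) (w : Y → ℝ) (I : (B → (Matrix.specialUnitaryGroup (Fin N) ℂ)) × Y → ℝ) (ip : ℝ),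
        (∀ x, 0 ≤ F x) → (∀ x, F x ≤ 1) → Integrable F (Measure.pi fun _ : B => haarProbability (Matrix.specialUnitaryGroup (Fin N) ℂ)) →
        (∀ y, 0 ≤ w y) →
        (∀ z : (B → (Matrix.specialUnitaryGroup (Fin N) ℂ)) × Y, F z.1 ≠ 0 → w z.2 ≠ 0 → 0 ≤ I z) →
        (∀ z : (B → (Matrix.specialUnitaryGroup (Fin N) ℂ)) × Y, z.1 ∈ (Set.univ.pi fun _ : B => {V : Matrix.specialUnitaryGroup (Fin N) ℂ | ‖(V : Matrix (Fin N) (Fin N) ℂ) - 1‖ ≤ η}) → w z.2 ≠ 0 → I z ≤ ip) →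
        Integrable (fun z : (B → (Matrix.specialUnitaryGroup (Fin N) ℂ)) × Y => F z.1 * w z.2) ((Measure.pi fun _ : B => haarProbability (Matrix.specialUnitaryGroup (Fin N) ℂ)).prod μ) →
        Integrable (fun z : (B → (Matrix.specialUnitaryGroup (Fin N) ℂ)) × Y => (Set.univ.pi fun _ : B => {V : Matrix.specialUnitaryGroup (Fin N) ℂ | ‖(V : Matrix (Fin N) (Fin N) ℂ) - 1‖ ≤ η}).indicator 1 z.1 * w z.2 * exp (-I z))
          ((Measure.pi fun _ : B => haarProbability (Matrix.specialUnitaryGroup (Fin N) ℂ)).prod μ) →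
        ∫ z, F z.1 * w z.2 * exp (-I z) ∂((Measure.pi fun _ : B => haarProbability (Matrix.specialUnitaryGroup (Fin N) ℂ)).prod μ) ≤
          exp (ip + (Fintype.card B : ℝ) * ((N * N : ℝ) * Real.log (2 / η) - Real.log C)) *
            ∫ z, (Set.univ.pi fun _ : B => {V : Matrix.specialUnitaryGroup (Fin N) ℂ | ‖(V : Matrix (Fin N) (Fin N) ℂ) - 1‖ ≤ η}).indicator 1 z.1 * w z.2 * exp (-I z)
              ∂((Measure.pi fun _ : B => haarProbability (Matrix.specialUnitaryGroup (Fin N) ℂ)).prod μ) := by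
  obtain ⟨C, hC, h⟩ := exists_neg_log_pi_sball_le (N := N) (B := B)
  refine ⟨C, hC, fun η hη hη2 F w I ip hF0 hF1 hFi hw0 hIpos hIsmall hA hB' => ?_⟩
  obtain ⟨hpos, hlog⟩ := h η hη hη2
  exact compactFibre_moment_le_window_exp (Measure.pi fun _ : B => haarProbability (Matrix.specialUnitaryGroup (Fin N) ℂ)) μ _
    (MeasurableSet.univ_pi fun _ => measurableSet_sball η) F w I hF0 hF1 hFi hw0 hIpos hIsmall hpos hlog hA hB'

end Region

/-! ## §4 The interaction letter `i⁺` on the window for `U(N) ⊇ SU(N)`, from the tree's Lemma 7.2 ∕ 7.4 -/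

section Interaction

variable {N : ℕ}

/-- **WINDOW BONDS MAKE WINDOW PLAQUETTES, `U(N)`**: if the four bond variables satisfy `‖1 − Uᵢ‖ ≤ ε` then the plaquette word has
`Re tr(1 − U₁U₂U₃⁻¹U₄⁻¹) ≤ 8ε²` (the tree's `norm_one_sub_plaquetteWord_le` and `re_trace_one_sub`). [folklore] -/
theorem re_trace_one_sub_plaquetteWord_le {ε : ℝ} (U₁ U₂ U₃ U₄ : Matrix.unitaryGroup (Fin N) ℂ)
    (h₁ : ‖(1 : Matrix (Fin N) (Fin N) ℂ) - U₁‖ ≤ ε) (h₂ : ‖(1 : Matrix (Fin N) (Fin N) ℂ) - U₂‖ ≤ ε) (h₃ : ‖(1 : Matrix (Fin N) (Fin N) ℂ) - U₃‖ ≤ ε) (h₄ : ‖(1 : Matrix (Fin N) (Fin N) ℂ) - U₄‖ ≤ ε) :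
    (Matrix.trace (1 - ((U₁ * U₂ * U₃⁻¹ * U₄⁻¹ : Matrix.unitaryGroup (Fin N) ℂ) : Matrix (Fin N) (Fin N) ℂ))).re ≤ 8 * ε ^ 2 := by
  rw [re_trace_one_sub (U₁ * U₂ * U₃⁻¹ * U₄⁻¹ : Matrix.unitaryGroup (Fin N) ℂ).2]
  have hle : ‖(1 : Matrix (Fin N) (Fin N) ℂ) - ((U₁ * U₂ * U₃⁻¹ * U₄⁻¹ : Matrix.unitaryGroup (Fin N) ℂ) : Matrix (Fin N) (Fin N) ℂ)‖ ≤ 4 * ε := by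
    linarith [norm_one_sub_plaquetteWord_le U₁ U₂ U₃ U₄]
  have h0 : 0 ≤ ‖(1 : Matrix (Fin N) (Fin N) ℂ) - ((U₁ * U₂ * U₃⁻¹ * U₄⁻¹ : Matrix.unitaryGroup (Fin N) ℂ) : Matrix (Fin N) (Fin N) ℂ)‖ := norm_nonneg _
  nlinarith

/-- **THE INTERACTION LETTER BY VALUE, `U(N)`**: over the finitely many plaquettes touching the region, each with its four bond variables
within `ε` of the identity, `Σ_{p ∈ s} β·Re tr(1 − U_p) ≤ #s·8βε²` (`β ≥ 0`; the Wilson weight's normalisation `1∕N` of the trace only lowers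
it). [folklore] -/
theorem interaction_le_of_window_unitary {P : Type*} (s : Finset P) {β ε : ℝ} (hβ : 0 ≤ β) (b₁ b₂ b₃ b₄ : P → (Matrix.unitaryGroup (Fin N) ℂ))
    (h : ∀ p ∈ s, ‖(1 : Matrix (Fin N) (Fin N) ℂ) - b₁ p‖ ≤ ε ∧ ‖(1 : Matrix (Fin N) (Fin N) ℂ) - b₂ p‖ ≤ ε ∧ ‖(1 : Matrix (Fin N) (Fin N) ℂ) - b₃ p‖ ≤ ε ∧ ‖(1 : Matrix (Fin N) (Fin N) ℂ) - b₄ p‖ ≤ ε) :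
    ∑ p ∈ s, β * (Matrix.trace (1 - ((b₁ p * b₂ p * (b₃ p)⁻¹ * (b₄ p)⁻¹ : Matrix.unitaryGroup (Fin N) ℂ) : Matrix (Fin N) (Fin N) ℂ))).re ≤ (s.card : ℝ) * (8 * β * ε ^ 2) := by
  have key : ∀ p ∈ s, β * (Matrix.trace (1 - ((b₁ p * b₂ p * (b₃ p)⁻¹ * (b₄ p)⁻¹ : Matrix.unitaryGroup (Fin N) ℂ) : Matrix (Fin N) (Fin N) ℂ))).re ≤ 8 * β * ε ^ 2 := by
    intro p hp
    have h8 := re_trace_one_sub_plaquetteWord_le (b₁ p) (b₂ p) (b₃ p) (b₄ p) (h p hp).1 (h p hp).2.1 (h p hp).2.2.1 (h p hp).2.2.2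
    nlinarith
  calc _ ≤ ∑ _p ∈ s, 8 * β * ε ^ 2 := Finset.sum_le_sum key
    _ = (s.card : ℝ) * (8 * β * ε ^ 2) := by rw [Finset.sum_const, nsmul_eq_mul]

end Interaction

end

end Summit.QuantumFields.BalabanUV.T4Continuum.NE7b.CompactFibreWindowSUN
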